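import Mathlib.Algebra.MvPolynomial.SchwartzZippel
import Mathlib.Algebra.MvPolynomial.PDeriv
import Mathlib.FieldTheory.Perfect
import Mathlib.FieldTheory.IsAlgClosed.Basic
import Literature.NumberTheory.DiophantineGeometry.BertiniHomogenizationProofs
import HarnessLib

/-!
# Rational points avoiding a hypersurface (Schwartz–Zippel) and a good direction for a line

Two elementary inputs of the effective Bertini argument behind Cafure–Matera (2006), Thm. 5.4:

* `exists_eval_ne_zero_of_totalDegree_lt_card`, `exists_eval_comp_ne_zero_of_totalDegree_lt_card`:
  a nonzero polynomial in `n` variables of total degree `< q` over (an extension of) `𝔽_q` does not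
  vanish at some point of `𝔽_qⁿ` (from Mathlib's Schwartz–Zippel lemma; Cafure–Matera use the
  equivalent count of Lemma 2.1, `#{zeros} ≤ deg · q^{n-1}`);
* `exists_pderiv_ne_zero`: an irreducible polynomial over an algebraically closed field has a
  nonzero partial derivative (otherwise it would be a `p`-th power), hence
  `exists_good_direction`: for `f ∈ 𝔽_q[x₁,…,xₙ]` absolutely irreducible of degree `δ` with
  `δ + 1 < q` there is a direction `v ∈ 𝔽_qⁿ` with `f_δ(v) ≠ 0` (the line direction is not
  asymptotic: `f(μ + Tv)` has degree `δ`) and `D_v f = ∑ vᵢ ∂ᵢ f ≠ 0` (the generic such line meets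
  `f = 0` transversally), the standing genericity behind Kaltofen's substitution (CM §3.2,
  condition (9): "the leading coefficient of `χ` w.r.t. `X` is nonzero" and "the discriminant of
  `χ(X, 0, …)` is nonzero").

## References

* A. Cafure, G. Matera, Finite Fields Appl. 12 (2006) 155–185, Lemma 2.1, §3.2. [CafureMatera2006]
* E. Kaltofen, J. Comput. System Sci. 50 (1995) 274–295, §3 Lemmas 4–5. [Kaltofen1995]
-/

noncomputable section

open scoped Classical
open MvPolynomial Finset

namespace Literature.NumberTheory.DiophantineGeometry

universe u v

/-! ### Schwartz–Zippel: points of `𝔽_qⁿ` avoiding a hypersurface of degree `< q` -/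

/-- **A nonzero polynomial of total degree `< q` over `𝔽_q` has a non-zero in `𝔽_qⁿ`**
(Schwartz–Zippel / Cafure–Matera Lemma 2.1). [cite: CafureMatera2006, Lemma 2.1] -/
theorem exists_eval_ne_zero_of_totalDegree_lt_card {K : Type u} [Field K] [Fintype K] {n : ℕ}
    {p : MvPolynomial (Fin n) K} (hp : p ≠ 0) (hdeg : p.totalDegree < Fintype.card K) :
    ∃ x : Fin n → K, MvPolynomial.eval x p ≠ 0 := by
  by_contra hall
  push Not at hall
  have hsz := MvPolynomial.schwartz_zippel_totalDegree hp (Finset.univ : Finset K)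
  have hq0 : (0 : ℚ≥0) < (Finset.univ : Finset K).card := by
    rw [Finset.card_univ]; exact_mod_cast Fintype.card_pos
  have hnum : #{x ∈ Fintype.piFinset fun _ : Fin n ↦ (Finset.univ : Finset K) |
      MvPolynomial.eval x p = 0} = (Finset.univ : Finset K).card ^ n := by
    rw [Finset.filter_true_of_mem fun x _ ↦ hall x, Fintype.card_piFinset, Finset.prod_const,
      Finset.card_univ, Finset.card_univ, Fintype.card_fin]
  rw [hnum] at hsz
  push_cast at hsz
  rw [div_self (pow_ne_zero _ hq0.ne')] at hsz
  have : (p.totalDegree : ℚ≥0) / (Finset.univ : Finset K).card < 1 := by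
    rw [div_lt_one hq0, Finset.card_univ]; exact_mod_cast hdeg
  exact absurd hsz (not_le.2 this)

/-- **A nonzero polynomial of total degree `< q` over a field containing `𝔽_q` has a non-zero among
the `𝔽_q`-rational points.** [cite: CafureMatera2006, Lemma 2.1] -/
theorem exists_eval_comp_ne_zero_of_totalDegree_lt_card {K : Type u} [Field K] [Fintype K]
    {L : Type v} [Field L] (σ : K →+* L) {n : ℕ} {p : MvPolynomial (Fin n) L} (hp : p ≠ 0)
    (hdeg : p.totalDegree < Fintype.card K) :
    ∃ x : Fin n → K, MvPolynomial.eval (σ ∘ x) p ≠ 0 := by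
  by_contra hall
  push Not at hall
  set S : Finset L := Finset.univ.image σ with hS
  have hScard : S.card = Fintype.card K := by
    rw [hS, Finset.card_image_of_injective _ σ.injective, Finset.card_univ]
  have hsz := MvPolynomial.schwartz_zippel_totalDegree hp S
  have hq0 : (0 : ℚ≥0) < S.card := by rw [hScard]; exact_mod_cast Fintype.card_pos
  have hnum : #{x ∈ Fintype.piFinset fun _ : Fin n ↦ S | MvPolynomial.eval x p = 0} = S.card ^ n := by
    rw [Finset.filter_true_of_mem, Fintype.card_piFinset, Finset.prod_const, Finset.card_univ,
      Fintype.card_fin]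
    intro x hx
    rw [Fintype.mem_piFinset] at hx
    choose y hy using fun i ↦ Finset.mem_image.1 (hx i)
    have : x = σ ∘ y := funext fun i ↦ (hy i).2.symm
    rw [this]
    exact hall y
  rw [hnum] at hsz
  push_cast at hsz
  rw [div_self (pow_ne_zero _ hq0.ne')] at hsz
  have : (p.totalDegree : ℚ≥0) / S.card < 1 := by
    rw [div_lt_one hq0, hScard]; exact_mod_cast hdeg
  exact absurd hsz (not_le.2 this)

/-! ### An irreducible polynomial has a nonzero partial derivative -/

/-- If all partial derivatives of `f` vanish then every exponent occurring in `f` is killed by the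
characteristic. [folklore] -/
theorem cast_eq_zero_of_forall_pderiv_eq_zero {E : Type u} [Field E] {σ : Type v}
    {f : MvPolynomial σ E} (h : ∀ i, pderiv i f = 0) {m : σ →₀ ℕ} (hm : m ∈ f.support) (i : σ) :
    (m i : E) = 0 := by
  by_cases hmi : m i = 0
  · rw [hmi, Nat.cast_zero]
  obtain ⟨k, hk⟩ := Nat.exists_eq_succ_of_ne_zero hmi
  have hc := coeff_pderiv (i := i) f (m - Finsupp.single i 1)
  rw [h i, coeff_zero] at hc
  have hm' : m - Finsupp.single i 1 + Finsupp.single i 1 = m := by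
    ext j
    simp only [Finsupp.coe_add, Finsupp.coe_tsub, Pi.add_apply, Pi.sub_apply,
      Finsupp.single_apply]
    split_ifs with hij
    · subst hij; omega
    · omega
  rw [hm'] at hc
  have hcoef : coeff m f ≠ 0 := mem_support_iff.1 hm
  have := (mul_eq_zero.1 hc.symm).resolve_left hcoef
  have hmi' : (((m - Finsupp.single i 1 : σ →₀ ℕ) i : ℕ) : E) + 1 = (m i : E) := by
    rw [Finsupp.tsub_apply, Finsupp.single_eq_same, hk, Nat.succ_sub_one]
    push_cast; ring
  rw [← hmi']
  exact_mod_cast this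

/-- **An irreducible polynomial over an algebraically closed field has a nonzero partial
derivative** (otherwise all exponents are divisible by the characteristic `p` and `f = hᵖ`, or
`f` is constant in characteristic `0`). [folklore] -/
theorem exists_pderiv_ne_zero {E : Type u} [Field E] [IsAlgClosed E] {σ : Type v}
    {f : MvPolynomial σ E} (hf : Irreducible f) : ∃ i, pderiv i f ≠ 0 := by
  by_contra hall
  push Not at hall
  have hcast := fun m hm i ↦ cast_eq_zero_of_forall_pderiv_eq_zero hall (m := m) hm i
  rcases CharP.char_is_prime_or_zero E (ringChar E) with hprime | hzero
  · -- characteristic `p`: `f` is a `p`-th power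
    set p := ringChar E with hp
    haveI : Fact p.Prime := ⟨hprime⟩
    haveI : CharP E p := ringChar.charP E
    haveI : ExpChar E p := ExpChar.prime hprime
    haveI : PerfectRing E p := PerfectField.toPerfectRing p
    have hdvd : ∀ m ∈ f.support, ∀ i, p ∣ m i := fun m hm i ↦
      (CharP.cast_eq_zero_iff E p (m i)).1 (hcast m hm i)
    -- the `p`-th root `h` of `f`
    set h : MvPolynomial σ E := ∑ m ∈ f.support,
      monomial (m.mapRange (· / p) (by simp)) ((frobeniusEquiv E p).symm (coeff m f)) with hh
    have hhp : h ^ p = f := by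
      rw [← frobenius_def, hh, map_sum]
      conv_rhs => rw [f.as_sum]
      refine Finset.sum_congr rfl fun m hm ↦ ?_
      have hsm : p • m.mapRange (· / p) (by simp) = m := by
        ext i
        rw [Finsupp.smul_apply, Finsupp.mapRange_apply, smul_eq_mul,
          Nat.mul_div_cancel' (hdvd m hm i)]
      rw [frobenius_def, monomial_pow, frobeniusEquiv_symm_pow_p, hsm]
    have hp2 : 2 ≤ p := hprime.two_le
    have hfac : f = h * h ^ (p - 1) := by
      rw [← pow_succ', Nat.sub_add_cancel (by omega), hhp]
    rcases hf.isUnit_or_isUnit hfac with hu | hu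
    · exact hf.not_isUnit (by rw [← hhp]; exact hu.pow p)
    · have hu' : IsUnit h := (isUnit_pow_iff (by omega)).1 hu
      exact hf.not_isUnit (by rw [← hhp]; exact hu'.pow p)
  · -- characteristic `0`: `f` is constant
    haveI : CharP E 0 := hzero ▸ ringChar.charP E
    haveI : CharZero E := CharP.charP_to_charZero E
    have hdeg : f.totalDegree = 0 := by
      rw [totalDegree_eq_zero_iff]
      intro m hm i
      exact_mod_cast hcast m hm i
    rw [totalDegree_eq_zero_iff_eq_C] at hdeg
    by_cases hc : coeff 0 f = 0
    · exact hf.ne_zero (by rw [hdeg, hc, map_zero])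
    · exact hf.not_isUnit (by rw [hdeg]; exact (IsUnit.mk0 _ hc).map C)

/-! ### A good direction `v`: `f_δ(v) ≠ 0` and `D_v f ≠ 0` -/

/-- The value of a linear form `∑ᵢ aᵢ Xᵢ` at `v` is `∑ aᵢ vᵢ`, the `m`-coefficient of
`∑ᵢ vᵢ ∂ᵢ f` when `aᵢ = coeff m (∂ᵢ f)`. [folklore] -/
theorem eval_sum_C_mul_X {K : Type u} [Field K] {n : ℕ} (a v : Fin n → K) :
    MvPolynomial.eval v (∑ i, C (a i) * X i) = ∑ i, a i * v i := by
  rw [map_sum]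
  refine Finset.sum_congr rfl fun i _ ↦ ?_
  rw [map_mul, eval_C, eval_X]

/-- A linear form with a nonzero coefficient is nonzero. [folklore] -/
theorem sum_C_mul_X_ne_zero {K : Type u} [Field K] {n : ℕ} {a : Fin n → K} {i₀ : Fin n}
    (h : a i₀ ≠ 0) : (∑ i, C (a i) * X i : MvPolynomial (Fin n) K) ≠ 0 := by
  intro h0
  have := congrArg (coeff (Finsupp.single i₀ 1)) h0
  rw [coeff_sum, coeff_zero, Finset.sum_eq_single i₀] at this
  · exact h (by simpa using this)
  · intro i _ hi
    rw [coeff_C_mul, coeff_X, if_neg, mul_zero]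
    intro heq
    exact hi (Finsupp.single_left_injective one_ne_zero heq)
  · intro hn; exact absurd (Finset.mem_univ _) hn

/-- A linear form has total degree `≤ 1`. [folklore] -/
theorem totalDegree_sum_C_mul_X_le {K : Type u} [Field K] {n : ℕ} (a : Fin n → K) :
    (∑ i, C (a i) * X i : MvPolynomial (Fin n) K).totalDegree ≤ 1 := by
  refine totalDegree_finsetSum_le fun i _ ↦ (totalDegree_mul _ _).trans ?_
  rw [totalDegree_C, zero_add]
  rcases subsingleton_or_nontrivial K with hK | hK
  · rw [Subsingleton.elim (X i : MvPolynomial (Fin n) K) 0, totalDegree_zero]; exact Nat.zero_le _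
  · rw [totalDegree_X]

/-- **A good direction for the line.** Let `f ∈ 𝔽_q[x₁,…,xₙ]` be absolutely irreducible
(irreducible over an algebraically closed `K̄ ⊇ 𝔽_q`) of total degree `δ` with `δ + 1 < q`.
Then some `v ∈ 𝔽_qⁿ` has `f_δ(v) ≠ 0` and `∑ᵢ vᵢ ∂ᵢ f ≠ 0`. Proof: some `∂_{i₀} f ≠ 0`
(`exists_pderiv_ne_zero` over `K̄`), so some coefficient `coeff m (∂_{i₀} f) ≠ 0`; apply
Schwartz–Zippel to `f_δ · ∑ᵢ coeff m (∂ᵢ f) Xᵢ`, of degree `≤ δ + 1`.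
[cite: CafureMatera2006, §3.2 condition (9)] -/
theorem exists_good_direction {K : Type u} [Field K] [Fintype K] {Kbar : Type v} [Field Kbar]
    [IsAlgClosed Kbar] (σ : K →+* Kbar) {n : ℕ} {f : MvPolynomial (Fin n) K}
    (hirr : Irreducible (MvPolynomial.map σ f)) (hq : f.totalDegree + 1 < Fintype.card K) :
    ∃ v : Fin n → K, MvPolynomial.eval v (homogeneousComponent f.totalDegree f) ≠ 0 ∧
      (∑ i, C (v i) * pderiv i f) ≠ 0 := by
  obtain ⟨i₀, hi₀⟩ := exists_pderiv_ne_zero hirr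
  rw [pderiv_map] at hi₀
  have hi₀' : pderiv i₀ f ≠ 0 := fun h ↦ hi₀ (by rw [h, map_zero])
  obtain ⟨m, hm⟩ : ∃ m, coeff m (pderiv i₀ f) ≠ 0 := by
    by_contra hnone
    push Not at hnone
    exact hi₀' (MvPolynomial.ext _ _ fun m ↦ by rw [hnone m, coeff_zero])
  have hf0 : f ≠ 0 := fun h ↦ hirr.ne_zero (by rw [h, map_zero])
  set ℓ : MvPolynomial (Fin n) K := ∑ i, C (coeff m (pderiv i f)) * X i with hℓ
  have hℓ0 : ℓ ≠ 0 := sum_C_mul_X_ne_zero (i₀ := i₀) hm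
  have hfδ0 : homogeneousComponent f.totalDegree f ≠ 0 := homogeneousComponent_totalDegree_ne_zero hf0
  have hQ0 : homogeneousComponent f.totalDegree f * ℓ ≠ 0 := mul_ne_zero hfδ0 hℓ0
  have hQdeg : (homogeneousComponent f.totalDegree f * ℓ).totalDegree < Fintype.card K := by
    refine lt_of_le_of_lt ((totalDegree_mul _ _).trans (Nat.add_le_add
      (homogeneousComponent_isHomogeneous _ _).totalDegree_le (totalDegree_sum_C_mul_X_le _))) hq
  obtain ⟨v, hv⟩ := exists_eval_ne_zero_of_totalDegree_lt_card hQ0 hQdeg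
  rw [map_mul, mul_ne_zero_iff] at hv
  refine ⟨v, hv.1, fun h0 ↦ hv.2 ?_⟩
  rw [hℓ, eval_sum_C_mul_X]
  have := congrArg (coeff m) h0
  rw [coeff_sum, coeff_zero] at this
  rw [← this]
  refine Finset.sum_congr rfl fun i _ ↦ ?_
  rw [coeff_C_mul, mul_comm]

end Literature.NumberTheory.DiophantineGeometry
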